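import Mathlib.Analysis.SpecialFunctions.Log.Deriv
import Mathlib.Analysis.SpecialFunctions.Pow.Deriv
import Literature.Geometry.Lorentzian.CoordEntropyFormula
import Literature.Geometry.Lorentzian.CoordLaplacianChainRule
import Literature.Geometry.Lorentzian.MetricNormSq
import HarnessLib

/-!
# Topping's Prop. 8.2.6 in coordinates: `□* v = −2τ|Ric + Hess f − g/2τ|² u` for a conjugate heat solution

The final layer of the coordinate computation of Perelman's entropy formula
(`CoordBochner`, `CoordEntropyEvolution`, `CoordEntropyFormula`). For a smooth one-parameter
family of metric components `G` on `V × S` satisfying the Ricci flow in coordinates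
`∂G/∂t = −2 Ric(G)`, the backwards time `τ(s) = c − s` (`dτ/dt = −1`, `τ > 0` on `S`), and a
**positive solution `u`, `C^∞` on `V × S`, of the conjugate heat equation**
`□* u = −∂_t u − Δu + Ru = 0` on `V × S` (Topping 2006, (6.4.8), Remark 8.2.2), we set, as in
Topping 2006, (8.1.1) and (8.2.3),

  `f = −log u − (n/2) log(4πτ)`  (so that `u = (4πτ)^{-n/2} e^{-f}`),
  `v = [τ(2Δf − |∇f|² + R) + f − n] u`,

and PROVE **Topping 2006, Prop. 8.2.6** pointwise in coordinates
(`IsMetricFamilyOn.conjHeat_entropyDensity_identity`):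

  `∂_t v + Δv − Rv = 2τ |Ric + Hess f − G/(2τ)|²_G u`   (i.e. `□* v = −2τ|Ric + Hess f − g/2τ|² u`),

together with its sign for positive definite components (`normSqAt_nonneg_of_posDef`,
`conjHeat_entropyDensity_nonneg`): `∂_t v + Δv − Rv ≥ 0`. The proof is Topping's reduction
(8.2.4) `u⁻¹ □* v = −(∂_t + Δ)(v/u) − 2u⁻¹⟨∇(v/u), ∇u⟩` — here the product rule for the
coordinate Laplacian, `Δ(Pu) = PΔu + uΔP + 2⟨∇P, ∇u⟩`, and `∇u = −u∇f` — combined with the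
identity for `P = v/u` of `CoordEntropyFormula` (`entropyIntegrand_identity`) and the passage
from the `u`-equation to the `f`-equation `∂f/∂t = −Δf + |∇f|² − R + n/(2τ)` (Topping's (8.2.1),
third line) by the chain rule for `log`.

Supporting material proved here: the chain rule for `hessAt`/`lapAt`/`gradSqAt` along a scalar
function `C²` only near the value (`hessAt_comp_of_contDiffAt`, for `log`), the product rule
`hessAt_mul`/`lapAt_mul`, and `|β|²_G ≥ 0` for positive definite `G`.
Everything is proved; the file introduces the definitions `conjHeatPotential` (`f` from `u`) and
`conjHeatEntropyDensity` (`v`), explicit expressions, and no statement of `Prop` type.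

## References

* P. Topping, *Lectures on the Ricci flow*, LMS Lecture Note Series 325, CUP 2006, Prop. 8.2.6
  with (8.2.3)–(8.2.4), Remark 8.2.2, (6.4.7)–(6.4.8), (8.1.1). [Topping2006]
* G. Perelman, *The entropy formula for the Ricci flow and its geometric applications*,
  arXiv:math/0211159 (2002), §9, Prop. 9.1. [Perelman2002]
* B. O'Neill, *Semi-Riemannian geometry with applications to relativity*, Academic Press 1983,
  Ch. 3, pp. 60–61. [ONeill1983]
-/

noncomputable section

set_option maxSynthPendingDepth 3

open Set Filter ContinuousLinearMap Module
open scoped Topology ContDiff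

namespace Literature.Geometry.Lorentzian

namespace MetricCoord

variable {E : Type*} [NormedAddCommGroup E] [NormedSpace ℝ E]

/-! ### `|β|²_G ≥ 0` for positive definite components -/

section Nonneg

variable [FiniteDimensional ℝ E] {G : E → E →L[ℝ] E →L[ℝ] ℝ} {x : E}

/-- **For positive definite symmetric `G x`, the metric square norm of any bilinear form is
nonnegative**: in a `G x`-orthogonal basis `|β|² = Σᵢⱼ β(bⱼ,bᵢ)²/(G(bᵢ,bᵢ)G(bⱼ,bⱼ)) ≥ 0`
(O'Neill 1983, Ch. 3, pp. 60–61; the frame formula `trace_comp_eq_sum_sq` of `MetricNormSq.lean`).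
[cite: ONeill1983, Ch. 3, pp. 60–61] -/
theorem normSqAt_nonneg_of_posDef (hs : ∀ v w : E, G x v w = G x w v)
    (hpos : ∀ v : E, v ≠ 0 → 0 < G x v v) (β : E →L[ℝ] E →L[ℝ] ℝ) :
    0 ≤ normSqAt G x β := by
  classical
  have hi : (G x).IsInvertible := isInvertible_of_nondegenerate fun v hv ↦ by
    by_contra hne
    exact (hpos v hne).ne' (hv v)
  -- the metric as an algebraic bilinear form and a `G x`-orthogonal basis
  set q : LinearMap.BilinForm ℝ E := (G x).toLinearMap₁₂ with hq
  have hqapp : ∀ v w, q v w = G x v w := fun v w ↦ rfl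
  have hqs : q.IsSymm := LinearMap.BilinForm.isSymm_def.2 fun v w ↦ by rw [hqapp, hqapp, hs v w]
  obtain ⟨b, hb⟩ := LinearMap.BilinForm.exists_orthogonal_basis
    (LinearMap.BilinForm.isSymm_iff.1 hqs)
  have hbpos : ∀ i, 0 < q (b i) (b i) := fun i ↦ hpos _ (b.ne_zero i)
  -- the two index raisings
  set T : LinearMap.BilinForm ℝ E := β.toLinearMap₁₂ with hT
  have hA : ∀ v w, q (((sharpAt G x).comp β : E →L[ℝ] E) v) w = T v w := fun v w ↦ by
    simp only [hqapp, ContinuousLinearMap.comp_apply, apply_sharpAt_apply hi]; rfl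
  have hB : ∀ v w, q (((sharpAt G x).comp β.flip : E →L[ℝ] E) v) w = T w v := fun v w ↦ by
    simp only [hqapp, ContinuousLinearMap.comp_apply, apply_sharpAt_apply hi, flip_apply]; rfl
  have key := trace_comp_eq_sum_sq b hb (fun i ↦ (hbpos i).ne') T
    (((sharpAt G x).comp β : E →L[ℝ] E) : E →ₗ[ℝ] E)
    (((sharpAt G x).comp β.flip : E →L[ℝ] E) : E →ₗ[ℝ] E) hA hB
  have hnorm : normSqAt G x β = LinearMap.trace ℝ E
      ((((sharpAt G x).comp β : E →L[ℝ] E) : E →ₗ[ℝ] E) ∘ₗ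
        (((sharpAt G x).comp β.flip : E →L[ℝ] E) : E →ₗ[ℝ] E)) := rfl
  rw [hnorm, key]
  exact Finset.sum_nonneg fun i _ ↦ Finset.sum_nonneg fun j _ ↦
    div_nonneg (sq_nonneg _) (mul_pos (hbpos i) (hbpos j)).le

end Nonneg

/-! ### The chain rule along a scalar function smooth near the value, and the product rule -/

section ChainRule

variable {G : E → E →L[ℝ] E →L[ℝ] ℝ} {g : ℝ → ℝ} {u : E → ℝ} {y : E}

/-- `D(g ∘ u)(y) = g'(u y) Du(y)` for `g` differentiable at `u y`. [folklore] -/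
theorem fderiv_comp_eq_of_differentiableAt (hg : DifferentiableAt ℝ g (u y))
    (hu : DifferentiableAt ℝ u y) :
    fderiv ℝ (fun z ↦ g (u z)) y = deriv g (u y) • fderiv ℝ u y :=
  (hg.hasDerivAt.comp_hasFDerivAt y hu.hasFDerivAt).fderiv

/-- **The second derivative of `g ∘ u` for `g` of class `C²` near `u y`** and `u` of class `C²`
at `y`: `D²(g ∘ u)(y) = g'(u y) D²u(y) + g''(u y) Du(y) ⊗ Du(y)`. [folklore] -/
theorem hasFDerivAt_fderiv_comp_of_contDiffAt (hg : ContDiffAt ℝ 2 g (u y)) (hu : ContDiffAt ℝ 2 u y) :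
    HasFDerivAt (fderiv ℝ fun z ↦ g (u z))
      (deriv g (u y) • fderiv ℝ (fderiv ℝ u) y
        + (deriv (deriv g) (u y) • fderiv ℝ u y).smulRight (fderiv ℝ u y)) y := by
  -- `g` is `C²` on a neighbourhood of `u y`, which `u` maps a neighbourhood of `y` into
  have hgev : ∀ᶠ w in 𝓝 (u y), ContDiffAt ℝ 2 g w := hg.eventually (by simp)
  have huc : ContinuousAt u y := hu.continuousAt
  have hev : ∀ᶠ z in 𝓝 y, ContDiffAt ℝ 2 u z ∧ ContDiffAt ℝ 2 g (u z) :=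
    (hu.eventually (by simp)).and (huc.eventually hgev)
  have heq : (fderiv ℝ fun z ↦ g (u z)) =ᶠ[𝓝 y] fun z ↦ deriv g (u z) • fderiv ℝ u z :=
    hev.mono fun z hz ↦ fderiv_comp_eq_of_differentiableAt (hz.2.differentiableAt (by simp))
      (hz.1.differentiableAt (by simp))
  refine HasFDerivAt.congr_of_eventuallyEq ?_ heq
  have hg1 : DifferentiableAt ℝ (deriv g) (u y) := by
    have h1 : ContDiffAt ℝ 1 (fun w ↦ fderiv ℝ g w (1 : ℝ)) (u y) :=
      (hg.fderiv_right (m := 1) (by norm_num)).clm_apply contDiffAt_const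
    have heq : deriv g = fun w ↦ fderiv ℝ g w (1 : ℝ) := funext fun w ↦ (fderiv_apply_one_eq_deriv).symm
    rw [heq]
    exact h1.differentiableAt one_ne_zero
  have hud : HasFDerivAt u (fderiv ℝ u y) y := (hu.differentiableAt (by norm_num)).hasFDerivAt
  have h1 : HasFDerivAt (fun z ↦ deriv g (u z)) (deriv (deriv g) (u y) • fderiv ℝ u y) y :=
    hg1.hasDerivAt.comp_hasFDerivAt y hud
  have h2 : HasFDerivAt (fderiv ℝ u) (fderiv ℝ (fderiv ℝ u) y) y :=
    ((hu.fderiv_right (m := 1) le_rfl).differentiableAt one_ne_zero).hasFDerivAt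
  exact h1.smul h2

/-- **The chain rule for the coordinate Hessian along `g` of class `C²` near the value**:
`Hess (g ∘ u)(y) = g'(u y) Hess u (y) + g''(u y) Du(y) ⊗ Du(y)`. [cite: ONeill1983, Ch. 3, Lemma 3.49] -/
theorem hessAt_comp_of_contDiffAt (hg : ContDiffAt ℝ 2 g (u y)) (hu : ContDiffAt ℝ 2 u y) :
    hessAt G (fun z ↦ g (u z)) y =
      deriv g (u y) • hessAt G u y
        + deriv (deriv g) (u y) • (fderiv ℝ u y).smulRight (fderiv ℝ u y) := by
  ext v w
  rw [hessAt_apply, (hasFDerivAt_fderiv_comp_of_contDiffAt hg hu).fderiv,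
    fderiv_comp_eq_of_differentiableAt (hg.differentiableAt (by norm_num))
      (hu.differentiableAt (by norm_num))]
  simp only [_root_.add_apply, _root_.smul_apply, smul_eq_mul,
    ContinuousLinearMap.smulRight_apply, hessAt_apply]
  ring

variable [FiniteDimensional ℝ E]

/-- **The chain rule for the coordinate Laplacian along `g` of class `C²` near the value**:
`Δ(g ∘ u)(y) = g'(u y) Δu(y) + g''(u y) |∇u|²(y)`. [cite: ONeill1983, Ch. 3, Def. 3.50] -/
theorem lapAt_comp_of_contDiffAt (hg : ContDiffAt ℝ 2 g (u y)) (hu : ContDiffAt ℝ 2 u y) :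
    lapAt G (fun z ↦ g (u z)) y =
      deriv g (u y) * lapAt G u y + deriv (deriv g) (u y) * gradSqAt G u y := by
  rw [lapAt, hessAt_comp_of_contDiffAt hg hu, mtrAt_add, mtrAt_smul, mtrAt_smul, mtrAt_smulRight,
    ← lapAt, gradSqAt_apply]

omit [FiniteDimensional ℝ E] in
/-- **`|∇(g ∘ u)|² = g'(u)² |∇u|²`.** [cite: ONeill1983, Ch. 3, p. 85] -/
theorem gradSqAt_comp_of_differentiableAt (hg : DifferentiableAt ℝ g (u y))
    (hu : DifferentiableAt ℝ u y) :
    gradSqAt G (fun z ↦ g (u z)) y = deriv g (u y) ^ 2 * gradSqAt G u y := by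
  rw [gradSqAt_apply, gradSqAt_apply, fderiv_comp_eq_of_differentiableAt hg hu]
  simp only [map_smul, _root_.smul_apply, smul_eq_mul]
  ring

end ChainRule

section ProductRule

variable (G : E → E →L[ℝ] E →L[ℝ] ℝ) {x : E} {u w : E → ℝ}

/-- `D(uw) = u Dw + w Du` near `x`, hence
`D²(uw)(x)(Y,Z) = u D²w(Y,Z) + w D²u(Y,Z) + Du(Y)Dw(Z) + Dw(Y)Du(Z)`. [folklore] -/
theorem fderiv_fderiv_mul_apply (hu : ContDiffAt ℝ 2 u x) (hw : ContDiffAt ℝ 2 w x) (Y Z : E) :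
    fderiv ℝ (fderiv ℝ (fun y ↦ u y * w y)) x Y Z =
      u x * fderiv ℝ (fderiv ℝ w) x Y Z + w x * fderiv ℝ (fderiv ℝ u) x Y Z
        + fderiv ℝ u x Y * fderiv ℝ w x Z + fderiv ℝ w x Y * fderiv ℝ u x Z := by
  have heu : ∀ᶠ y in 𝓝 x, ContDiffAt ℝ 2 u y := hu.eventually (by simp)
  have hew : ∀ᶠ y in 𝓝 x, ContDiffAt ℝ 2 w y := hw.eventually (by simp)
  have heq : fderiv ℝ (fun y ↦ u y * w y) =ᶠ[𝓝 x] fun y ↦ u y • fderiv ℝ w y + w y • fderiv ℝ u y := by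
    filter_upwards [heu, hew] with y hyu hyw
    exact fderiv_fun_mul (hyu.differentiableAt (by simp)) (hyw.differentiableAt (by simp))
  rw [heq.fderiv_eq]
  have hdu : DifferentiableAt ℝ u x := hu.differentiableAt (by simp)
  have hdw : DifferentiableAt ℝ w x := hw.differentiableAt (by simp)
  have hDu : DifferentiableAt ℝ (fderiv ℝ u) x := (hu.fderiv_right (m := 1) le_rfl).differentiableAt one_ne_zero
  have hDw : DifferentiableAt ℝ (fderiv ℝ w) x := (hw.fderiv_right (m := 1) le_rfl).differentiableAt one_ne_zero
  have hd : HasFDerivAt (fun y ↦ u y • fderiv ℝ w y + w y • fderiv ℝ u y)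
      ((u x • fderiv ℝ (fderiv ℝ w) x + (fderiv ℝ u x).smulRight (fderiv ℝ w x)) +
        (w x • fderiv ℝ (fderiv ℝ u) x + (fderiv ℝ w x).smulRight (fderiv ℝ u x))) x := by
    exact (hdu.hasFDerivAt.smul hDw.hasFDerivAt).add (hdw.hasFDerivAt.smul hDu.hasFDerivAt)
  rw [hd.fderiv]
  simp only [_root_.add_apply, _root_.smul_apply, smul_eq_mul, ContinuousLinearMap.smulRight_apply]
  ring

/-- **The product rule for the coordinate Hessian**:
`Hess(uw)(Y,Z) = u Hess w(Y,Z) + w Hess u(Y,Z) + Du(Y)Dw(Z) + Dw(Y)Du(Z)`. [folklore] -/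
theorem hessAt_mul_apply (hu : ContDiffAt ℝ 2 u x) (hw : ContDiffAt ℝ 2 w x) (Y Z : E) :
    hessAt G (fun y ↦ u y * w y) x Y Z =
      u x * hessAt G w x Y Z + w x * hessAt G u x Y Z
        + fderiv ℝ u x Y * fderiv ℝ w x Z + fderiv ℝ w x Y * fderiv ℝ u x Z := by
  simp only [hessAt_apply, fderiv_fderiv_mul_apply hu hw,
    fderiv_fun_mul (hu.differentiableAt (by simp)) (hw.differentiableAt (by simp)),
    _root_.add_apply, _root_.smul_apply, smul_eq_mul]
  ring

/-- The product rule as an identity of bilinear forms. [folklore] -/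
theorem hessAt_mul (hu : ContDiffAt ℝ 2 u x) (hw : ContDiffAt ℝ 2 w x) :
    hessAt G (fun y ↦ u y * w y) x =
      u x • hessAt G w x + w x • hessAt G u x
        + (fderiv ℝ u x).smulRight (fderiv ℝ w x) + (fderiv ℝ w x).smulRight (fderiv ℝ u x) := by
  ext Y Z
  simp only [hessAt_mul_apply G hu hw, _root_.add_apply, _root_.smul_apply, smul_eq_mul,
    ContinuousLinearMap.smulRight_apply]

variable [FiniteDimensional ℝ E]

/-- **The product rule for the coordinate Laplacian**: `Δ(uw) = u Δw + w Δu + 2 Du(♯Dw)`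
(`⟨∇u, ∇w⟩ = Du(♯Dw)`; Topping 2006, proof of Prop. 8.2.6, first display).
[cite: Topping2006, proof of Prop. 8.2.6, (8.2.4)] -/
theorem lapAt_mul (hx : (G x).IsInvertible) (hs : ∀ v w' : E, G x v w' = G x w' v)
    (hu : ContDiffAt ℝ 2 u x) (hw : ContDiffAt ℝ 2 w x) :
    lapAt G (fun y ↦ u y * w y) x =
      u x * lapAt G w x + w x * lapAt G u x + 2 * fderiv ℝ u x (sharpAt G x (fderiv ℝ w x)) := by
  rw [lapAt, hessAt_mul G hu hw, mtrAt_add, mtrAt_add, mtrAt_add, mtrAt_smul, mtrAt_smul,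
    mtrAt_smulRight, mtrAt_smulRight, ← lapAt, ← lapAt]
  have hsw : fderiv ℝ w x (sharpAt G x (fderiv ℝ u x)) = fderiv ℝ u x (sharpAt G x (fderiv ℝ w x)) := by
    rw [← apply_sharpAt_apply hx (fderiv ℝ w x) (sharpAt G x (fderiv ℝ u x)), hs,
      apply_sharpAt_apply hx]
  rw [hsw]
  ring

end ProductRule

/-! ### From a positive conjugate heat solution `u` to `f`, `v`, and Prop. 8.2.6 -/

section ConjugateHeat

variable [FiniteDimensional ℝ E] [CompleteSpace E]

/-- **The potential `f` of a positive density** `u` for the backwards time `τ(s) = c − s`: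
`f = −log u − (n/2) log(4πτ)`, so that `u = (4πτ)^{-n/2} e^{-f}` (Topping 2006, (8.1.1) and
(6.4.7); Perelman 2002, §3.1). [cite: Topping2006, (8.1.1)] -/
def conjHeatPotential (u : ℝ → E → ℝ) (c : ℝ) (s : ℝ) (y : E) : ℝ :=
  -Real.log (u s y) - (finrank ℝ E : ℝ) / 2 * Real.log (4 * Real.pi * (c - s))

omit [FiniteDimensional ℝ E] [CompleteSpace E] in
/-- Unfolding lemma for `conjHeatPotential`. [cite: Topping2006, (8.1.1)] -/
theorem conjHeatPotential_apply (u : ℝ → E → ℝ) (c s : ℝ) (y : E) :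
    conjHeatPotential u c s y =
      -Real.log (u s y) - (finrank ℝ E : ℝ) / 2 * Real.log (4 * Real.pi * (c - s)) := rfl

/-- **Perelman's `v`** (Topping 2006, (8.2.3); Perelman 2002, Prop. 9.1):
`v = [τ(2Δf − |∇f|² + R) + f − n] u` with `f = conjHeatPotential u c`, `τ(s) = c − s`.
[cite: Topping2006, (8.2.3)] -/
def conjHeatEntropyDensity (G : ℝ → E → E →L[ℝ] E →L[ℝ] ℝ) (u : ℝ → E → ℝ) (c : ℝ) (s : ℝ) (y : E) : ℝ :=
  entropyIntegrand G (conjHeatPotential u c) (fun s ↦ c - s) s y * u s y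

omit [CompleteSpace E] in
/-- Unfolding lemma for `conjHeatEntropyDensity`. [cite: Topping2006, (8.2.3)] -/
theorem conjHeatEntropyDensity_apply (G : ℝ → E → E →L[ℝ] E →L[ℝ] ℝ) (u : ℝ → E → ℝ) (c s : ℝ) (y : E) :
    conjHeatEntropyDensity G u c s y =
      entropyIntegrand G (conjHeatPotential u c) (fun s ↦ c - s) s y * u s y := rfl

namespace IsMetricFamilyOn

variable {G : ℝ → E → E →L[ℝ] E →L[ℝ] ℝ} {S : Set ℝ} {V : Set E} {x : E} {t : ℝ} {u : ℝ → E → ℝ}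
  {c : ℝ}

omit [FiniteDimensional ℝ E] [CompleteSpace E] in
/-- The potential `f = −log u − (n/2)log(4π(c − s))` is `C^∞` on `V × S` for a positive `u`,
`C^∞` on `V × S`, and `c − s > 0` on `S`. [folklore] -/
theorem contDiffOn_conjHeatPotential (hu : ContDiffOn ℝ ∞ (fun p : E × ℝ ↦ u p.2 p.1) (V ×ˢ S))
    (hpos : ∀ s ∈ S, ∀ y ∈ V, 0 < u s y) (hc : ∀ s ∈ S, s < c) :
    ContDiffOn ℝ ∞ (fun p : E × ℝ ↦ conjHeatPotential u c p.2 p.1) (V ×ˢ S) := by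
  have h1 : ContDiffOn ℝ ∞ (fun p : E × ℝ ↦ Real.log (u p.2 p.1)) (V ×ˢ S) :=
    hu.log fun p hp ↦ (hpos p.2 hp.2 p.1 hp.1).ne'
  have h2 : ContDiffOn ℝ ∞ (fun p : E × ℝ ↦ Real.log (4 * Real.pi * (c - p.2))) (V ×ˢ S) := by
    refine ContDiffOn.log ?_ fun p hp ↦ ?_
    · exact (contDiffOn_const.mul (contDiffOn_const.sub contDiffOn_snd))
    · have := hc p.2 hp.2
      have hπ := Real.pi_pos
      positivity
  simp only [conjHeatPotential]
  exact h1.neg.sub (contDiffOn_const.mul h2)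

omit [FiniteDimensional ℝ E] [CompleteSpace E] in
/-- The slices of a `C^∞` family on `V × S` restrict to `C^∞` families on `V × S'`, `S' ⊆ S`.
[folklore] -/
theorem contDiffOn_family_mono {F : ℝ → E → ℝ} {S' : Set ℝ}
    (hF : ContDiffOn ℝ ∞ (fun p : E × ℝ ↦ F p.2 p.1) (V ×ˢ S)) (hS' : S' ⊆ S) :
    ContDiffOn ℝ ∞ (fun p : E × ℝ ↦ F p.2 p.1) (V ×ˢ S') :=
  hF.mono (prod_mono Subset.rfl hS')

omit [FiniteDimensional ℝ E] [CompleteSpace E] in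
/-- **The time derivative of the potential**: `∂_t f = −(∂_t u)/u + n/(2τ)`, `τ = c − t`
(`dτ/dt = −1`). [cite: Topping2006, (8.2.1)] -/
theorem tDerivFun_conjHeatPotential (hG : IsMetricFamilyOn G S V)
    (hu : ContDiffOn ℝ ∞ (fun p : E × ℝ ↦ u p.2 p.1) (V ×ˢ S))
    (hpos : ∀ s ∈ S, ∀ y ∈ V, 0 < u s y) (hc : ∀ s ∈ S, s < c) (hx : x ∈ V) (ht : t ∈ S) :
    tDerivFun (conjHeatPotential u c) S t x =
      -(tDerivFun u S t x) / u t x + (finrank ℝ E : ℝ) / (2 * (c - t)) := by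
  have hu0 : 0 < u t x := hpos t ht x hx
  have hct : 0 < c - t := sub_pos.2 (hc t ht)
  have hd := hasDerivWithinAt_of_family hu hx ht
  have h1 : HasDerivWithinAt (fun s ↦ Real.log (u s x)) (tDerivFun u S t x / u t x) S t := by
    simpa using hd.log hu0.ne'
  have h2 : HasDerivWithinAt (fun s ↦ Real.log (4 * Real.pi * (c - s)))
      ((4 * Real.pi * (-1)) / (4 * Real.pi * (c - t))) S t := by
    have hl : HasDerivWithinAt (fun s ↦ 4 * Real.pi * (c - s)) (4 * Real.pi * (-1)) S t := by
      simpa using ((hasDerivWithinAt_id t S).const_sub c).const_mul (4 * Real.pi)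
    exact hl.log (by positivity)
  have h : HasDerivWithinAt (fun s ↦ conjHeatPotential u c s x)
      (-(tDerivFun u S t x / u t x)
        - (finrank ℝ E : ℝ) / 2 * ((4 * Real.pi * (-1)) / (4 * Real.pi * (c - t)))) S t := by
    exact h1.neg.sub (h2.const_mul ((finrank ℝ E : ℝ) / 2))
  rw [tDerivFun, h.derivWithin (hG.uniqueDiffOn t ht)]
  have hπ : Real.pi ≠ 0 := Real.pi_pos.ne'
  field_simp
  ring

omit [FiniteDimensional ℝ E] [CompleteSpace E] in
/-- **`Du = −u Df`** for `f = −log u − const`: the differential of the density in terms of the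
potential. [cite: Topping2006, proof of Prop. 8.2.6, (8.2.8)] -/
theorem fderiv_eq_neg_mul_fderiv_conjHeatPotential
    (hu : ContDiffOn ℝ ∞ (fun p : E × ℝ ↦ u p.2 p.1) (V ×ˢ S)) (hV : IsOpen V)
    (hpos : ∀ s ∈ S, ∀ y ∈ V, 0 < u s y) (hx : x ∈ V) (ht : t ∈ S) :
    fderiv ℝ (u t) x = -(u t x) • fderiv ℝ (conjHeatPotential u c t) x := by
  have hu0 : 0 < u t x := hpos t ht x hx
  have hut : ContDiffOn ℝ ∞ (u t) V := contDiffOn_of_family hu ht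
  have hdu : DifferentiableAt ℝ (u t) x :=
    ((hut x hx).contDiffAt (hV.mem_nhds hx)).differentiableAt (by simp)
  have hf : conjHeatPotential u c t = fun y ↦ -Real.log (u t y)
      - (finrank ℝ E : ℝ) / 2 * Real.log (4 * Real.pi * (c - t)) := rfl
  rw [hf, fderiv_sub_const]
  have hlog : fderiv ℝ (fun y ↦ -Real.log (u t y)) x = -((u t x)⁻¹ • fderiv ℝ (u t) x) := by
    have h : HasFDerivAt (fun y ↦ -Real.log (u t y)) (-((u t x)⁻¹ • fderiv ℝ (u t) x)) x := by
      exact ((Real.hasDerivAt_log hu0.ne').comp_hasFDerivAt x hdu.hasFDerivAt).neg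
    rw [h.fderiv]
  rw [hlog, smul_neg, neg_smul, neg_neg, smul_smul, mul_inv_cancel₀ hu0.ne', one_smul]

omit [CompleteSpace E] in
/-- **The conjugate heat equation for `u` is the third equation of (8.2.1) for `f`**: if
`∂_t u = −Δu + Ru` at `(x, t)` then `∂_t f = −Δf + |∇f|² − R + n/(2τ)` at `(x, t)`
(`Δ log u = Δu/u − |∇u|²/u²`, `|∇ log u|² = |∇u|²/u²`; Topping 2006, Remark 8.2.2 / (6.4.6)–(6.4.8)).
[cite: Topping2006, Remark 8.2.2] -/
theorem tDerivFun_conjHeatPotential_eq (hG : IsMetricFamilyOn G S V)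
    (hu : ContDiffOn ℝ ∞ (fun p : E × ℝ ↦ u p.2 p.1) (V ×ˢ S))
    (hpos : ∀ s ∈ S, ∀ y ∈ V, 0 < u s y) (hc : ∀ s ∈ S, s < c) (hx : x ∈ V) (ht : t ∈ S)
    (hueq : tDerivFun u S t x = -lapAt (G t) (u t) x + scalAt (G t) x * u t x) :
    tDerivFun (conjHeatPotential u c) S t x =
      -lapAt (G t) (conjHeatPotential u c t) x + gradSqAt (G t) (conjHeatPotential u c t) x
        - scalAt (G t) x + (finrank ℝ E : ℝ) / (2 * (c - t)) := by
  have hV := hG.isOpen ht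
  have hu0 : 0 < u t x := hpos t ht x hx
  have hut : ContDiffOn ℝ ∞ (u t) V := contDiffOn_of_family hu ht
  have h2u : ContDiffAt ℝ 2 (u t) x := contDiffAt_two_of_contDiffOn hV hut hx
  have hdu : DifferentiableAt ℝ (u t) x := h2u.differentiableAt (by simp)
  have hlog2 : ContDiffAt ℝ 2 Real.log (u t x) := Real.contDiffAt_log.2 hu0.ne'
  -- `Δf` and `|∇f|²` by the chain rule for `log`
  have hf : conjHeatPotential u c t = fun y ↦ (-1) * Real.log (u t y)
      - (finrank ℝ E : ℝ) / 2 * Real.log (4 * Real.pi * (c - t)) := by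
    funext y; simp [conjHeatPotential_apply]
  have h2log : ContDiffAt ℝ 2 (fun y ↦ Real.log (u t y)) x := hlog2.comp x h2u
  have hL : lapAt (G t) (conjHeatPotential u c t) x =
      -((u t x)⁻¹ * lapAt (G t) (u t) x + (-(u t x ^ 2)⁻¹) * gradSqAt (G t) (u t) x) := by
    have hd2 : deriv (deriv Real.log) (u t x) = -((u t x) ^ 2)⁻¹ := by
      rw [Real.deriv_log']
      exact deriv_inv
    rw [hf, lapAt_sub_const, lapAt_const_mul _ h2log, lapAt_comp_of_contDiffAt hlog2 h2u,
      Real.deriv_log, hd2]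
    ring
  have hgr : gradSqAt (G t) (conjHeatPotential u c t) x = (u t x)⁻¹ ^ 2 * gradSqAt (G t) (u t) x := by
    rw [hf]
    have h1 : gradSqAt (G t) (fun y ↦ (-1) * Real.log (u t y)
        - (finrank ℝ E : ℝ) / 2 * Real.log (4 * Real.pi * (c - t))) x =
        gradSqAt (G t) (fun y ↦ (-1) * Real.log (u t y)) x := by
      simp only [gradSqAt_apply, fderiv_sub_const]
    rw [h1]
    have h2 : gradSqAt (G t) (fun y ↦ (-1) * Real.log (u t y)) x =
        gradSqAt (G t) (fun y ↦ Real.log (u t y)) x := by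
      simp only [gradSqAt_apply, fderiv_const_mul (h2log.differentiableAt (by simp)), map_smul,
        _root_.smul_apply, smul_eq_mul]
      ring
    rw [h2, gradSqAt_comp_of_differentiableAt (hlog2.differentiableAt (by simp)) hdu, Real.deriv_log]
  rw [hG.tDerivFun_conjHeatPotential hu hpos hc hx ht, hueq, hL, hgr]
  field_simp
  ring

variable (hG : IsMetricFamilyOn G S V)
  (hfl : ∀ s ∈ S, ∀ y ∈ V, tDeriv G S s y = (-2 : ℝ) • ricAt (G s) y)
include hG hfl

/-- **Topping 2006, Prop. 8.2.6, in coordinates.** Let `G` be a smooth one-parameter family of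
metric components on `V × S` satisfying the Ricci flow in coordinates `∂G/∂t = −2Ric(G)`, let
`τ(s) = c − s` with `s < c` on `S`, and let `u > 0` be `C^∞` on `V × S` and solve the conjugate
heat equation `∂_t u = −Δu + Ru` on `V × {t}` (`□*u = 0`, Topping (6.4.8), Remark 8.2.2). Then
at `x ∈ V`, with `f = −log u − (n/2)log(4πτ)` and `v = [τ(2Δf − |∇f|² + R) + f − n] u`
(`conjHeatEntropyDensity`),

  `∂_t v + Δv − Rv = 2τ |Ric + Hess f − G/(2τ)|²_G · u`,

i.e. `□* v = −2τ|Ric + Hess f − g/2τ|² u`. Proof: Topping's (8.2.4) — the product rules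
`∂_t(Pu) = u ∂_t P + P ∂_t u`, `Δ(Pu) = uΔP + PΔu + 2⟨∇P, ∇u⟩` with `∇u = −u∇f` and
`□*u = 0` — reduce to `u (∂_t P + ΔP − 2⟨∇P, ∇f⟩)`, which is `entropyIntegrand_identity`.
[cite: Topping2006, Prop. 8.2.6] [cite: Perelman2002, §9, Prop. 9.1] -/
theorem conjHeat_entropyDensity_identity
    (hu : ContDiffOn ℝ ∞ (fun p : E × ℝ ↦ u p.2 p.1) (V ×ˢ S))
    (hpos : ∀ s ∈ S, ∀ y ∈ V, 0 < u s y) (hc : ∀ s ∈ S, s < c) (hx : x ∈ V) (ht : t ∈ S)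
    (hueq : ∀ y ∈ V, tDerivFun u S t y = -lapAt (G t) (u t) y + scalAt (G t) y * u t y) :
    tDerivFun (conjHeatEntropyDensity G u c) S t x
        + lapAt (G t) (conjHeatEntropyDensity G u c t) x
        - scalAt (G t) x * conjHeatEntropyDensity G u c t x =
      2 * (c - t) * normSqAt (G t) x (ricAt (G t) x + hessAt (G t) (conjHeatPotential u c t) x
        - (2 * (c - t))⁻¹ • G t x) * u t x := by
  have hGt := hG.isMetricOn t ht
  have hi := hGt.isInvertible x hx
  have hs := hGt.symm x hx
  have hV := hG.isOpen ht
  have hct : 0 < c - t := sub_pos.2 (hc t ht)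
  set f := conjHeatPotential u c with hfdef
  set τ : ℝ → ℝ := fun s ↦ c - s with hτdef
  have hf : ContDiffOn ℝ ∞ (fun p : E × ℝ ↦ f p.2 p.1) (V ×ˢ S) :=
    contDiffOn_conjHeatPotential hu hpos hc
  have hτ : HasDerivWithinAt τ (-1) S t := by
    simpa [hτdef] using (hasDerivWithinAt_id t S).const_sub c
  have hτ0 : τ t ≠ 0 := hct.ne'
  -- the `f`-equation on `V × {t}`
  have hfeq : ∀ y ∈ V, tDerivFun f S t y = -lapAt (G t) (f t) y + gradSqAt (G t) (f t) y
      - scalAt (G t) y + finrank ℝ E / (2 * τ t) := fun y hy ↦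
    hG.tDerivFun_conjHeatPotential_eq hu hpos hc hy ht (hueq y hy)
  -- the identity for `P`
  have hP := hG.entropyIntegrand_identity hfl hf hτ hτ0 hx ht hfeq
  -- smoothness of the slices at time `t`
  have hut : ContDiffOn ℝ ∞ (u t) V := contDiffOn_of_family hu ht
  have hft : ContDiffOn ℝ ∞ (f t) V := contDiffOn_of_family hf ht
  have hPt : ContDiffOn ℝ ∞ (entropyIntegrand G f τ t) V :=
    ((contDiffOn_const.mul (((contDiffOn_const.mul (hGt.contDiffOn_lapAt hft)).sub
      (hGt.contDiffOn_gradSqAt hft)).add hGt.contDiffOn_scalAt)).add hft).sub contDiffOn_const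
  have h2u := contDiffAt_two_of_contDiffOn hV hut hx
  have h2P := contDiffAt_two_of_contDiffOn hV hPt hx
  -- time derivatives at `(x, t)`
  have hdu := hasDerivWithinAt_of_family hu hx ht
  have hdPt : HasDerivWithinAt (fun s ↦ entropyIntegrand G f τ s x)
      (tDerivFun (entropyIntegrand G f τ) S t x) S t :=
    (hG.hasDerivWithinAt_entropyIntegrand hfl hf hτ hx ht).differentiableWithinAt.hasDerivWithinAt
  have hdv : tDerivFun (conjHeatEntropyDensity G u c) S t x =
      tDerivFun (entropyIntegrand G f τ) S t x * u t x
        + entropyIntegrand G f τ t x * tDerivFun u S t x := by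
    have h := hdPt.mul hdu
    exact h.derivWithin (hG.uniqueDiffOn t ht)
  -- the Laplacian of the product
  have hLv : lapAt (G t) (conjHeatEntropyDensity G u c t) x =
      entropyIntegrand G f τ t x * lapAt (G t) (u t) x + u t x * lapAt (G t) (entropyIntegrand G f τ t) x
        + 2 * fderiv ℝ (entropyIntegrand G f τ t) x (sharpAt (G t) x (fderiv ℝ (u t) x)) := by
    have h := lapAt_mul (G t) hi hs h2P h2u
    exact h
  -- `Du = −u Df`
  have hDu : fderiv ℝ (u t) x = -(u t x) • fderiv ℝ (f t) x :=
    fderiv_eq_neg_mul_fderiv_conjHeatPotential hu hV hpos hx ht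
  rw [hdv, hLv, hDu, map_smul, map_smul, conjHeatEntropyDensity_apply, hueq x hx, ← hP]
  simp only [smul_eq_mul]
  ring

/-- **The sign in Prop. 8.2.6 for positive definite components**: under the hypotheses of
`conjHeat_entropyDensity_identity`, if `G t x` is positive definite then
`∂_t v + Δv − Rv ≥ 0` (`|Ric + Hess f − g/2τ|² ≥ 0`, `τ > 0`, `u > 0`). This is the pointwise
inequality integrated in Topping's Remark 8.2.7 to give `dW/dt ≥ 0`.
[cite: Topping2006, Prop. 8.2.6 and Remark 8.2.7] -/
theorem conjHeat_entropyDensity_nonneg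
    (hu : ContDiffOn ℝ ∞ (fun p : E × ℝ ↦ u p.2 p.1) (V ×ˢ S))
    (hpos : ∀ s ∈ S, ∀ y ∈ V, 0 < u s y) (hc : ∀ s ∈ S, s < c) (hx : x ∈ V) (ht : t ∈ S)
    (hueq : ∀ y ∈ V, tDerivFun u S t y = -lapAt (G t) (u t) y + scalAt (G t) y * u t y)
    (hposdef : ∀ v : E, v ≠ 0 → 0 < G t x v v) :
    0 ≤ tDerivFun (conjHeatEntropyDensity G u c) S t x
        + lapAt (G t) (conjHeatEntropyDensity G u c t) x
        - scalAt (G t) x * conjHeatEntropyDensity G u c t x := by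
  have hGt := hG.isMetricOn t ht
  rw [hG.conjHeat_entropyDensity_identity hfl hu hpos hc hx ht hueq]
  have hct : 0 < c - t := sub_pos.2 (hc t ht)
  have hn := normSqAt_nonneg_of_posDef (hGt.symm x hx) hposdef
    (ricAt (G t) x + hessAt (G t) (conjHeatPotential u c t) x - (2 * (c - t))⁻¹ • G t x)
  have hu0 := hpos t ht x hx
  positivity

end IsMetricFamilyOn

end ConjugateHeat

end MetricCoord

end Literature.Geometry.Lorentzian

end
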